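import Summits.NavierStokesRegularity.OSWSelfSimilar.SheetNSLineSchochetTwoPoleBlowup
import HarnessLib

/-!
# The lifespan law of the small Schochet datum: `T ≍ 1/‖ω₀‖_∞` with `ν`-INDEPENDENT constants

HONEST FRAMING (cell ns-blowup GROUP B «PROFILE SEARCH», zone Z3, rows Z3-U (A-F2) / Z3-E12⁻ (clause (i′)) of
`HOME/profile/z3/CENSUS-Z3.md`; human rulings D-0035/D-0074): **1-D MODEL (viscous CLM `ω_t = ω·Hω + ν ω_xx` on `ℝ`, genuine
`hilbertTransform`); not Euler, not Navier–Stokes; «violates: none — MODEL».**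

THE NUMBER (`viscousCLM_line_lifespan_law`). For the small-data blow-up family of `SheetNSLineSchochetTwoPoleBlowup` (depths
`L, 2L`, `k = 3 + √6`, `T = L²/(5kν)`): there is `M` (`= 123ν/L² ≤ ε`) with `sup_x |ω₀(x)| ≤ M`, `|ω₀(L)| ≥ M/3`
(indeed `ω₀(L) = −(7.2k + 7.92)ν/L²`), and **`4 ≤ T·M ≤ 5`** — so the blow-up time of the datum satisfies
`4/3 ≤ T·‖ω₀‖_∞ ≤ 5` with constants that do NOT depend on `ν` (exactly: `T·‖ω₀‖_∞ = 24.6/k · (‖ω₀‖_∞ L²/(123ν))`;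
numerically `T·‖ω₀‖_∞ ≈ 1.85`): on the MODEL the NS-type dissipation neither prevents NOR DELAYS the `a = 0` collapse beyond the
inviscid time scale `‖ω₀‖_∞^{−1}`, however large `ν` is relative to the datum. WHAT IS NOT HERE: the exact value of `sup|ω₀|`;
anything about other data or about Navier–Stokes. No definitions, no named facts. bears_on: LADDER-NS N5 / zone Z3 → N1 linear core.
-/

noncomputable section

namespace Summit.NavierStokesRegularity.OSWSelfSimilar
namespace SheetNSLineSchochetTwoPole

open _root_.MeasureTheory Set Filter Literature.Analysis.Fourier
open scoped Real Topology

/-- **Lifespan law `T ≍ ‖ω₀‖_∞^{−1}`, `ν`-independent.** For every `ν > 0`, `ε > 0`: a classical solution of the viscous CLM on `ℝ`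
(genuine `hilbertTransform`) on `[0, T)` blowing up at `T` (`sup_x|ω(t,x)| → ∞`), whose datum satisfies `sup|ω₀| ≤ M ≤ ε`,
`|ω₀(x₀)| ≥ M/3` at some `x₀`, and `4 ≤ T·M ≤ 5`. [cite: AmbroseLushnikovSiegelSilantyev2024, §5.1.1
(`t_c = −(12/5)x₁(0)x₂(0)/(K_±ν)` for Schochet's solution)] -/
theorem viscousCLM_line_lifespan_law (ν ε : ℝ) (hν : 0 < ν) (hε : 0 < ε) :
    ∃ T : ℝ, 0 < T ∧ ∃ ω ωx ωxx : ℝ → ℝ → ℝ,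
      (∀ t x, 0 ≤ t → t < T → HasDerivAt (ω t) (ωx t x) x) ∧
      (∀ t x, 0 ≤ t → t < T → HasDerivAt (ωx t) (ωxx t x) x) ∧
      (∀ t x, 0 ≤ t → t < T →
        HasDerivAt (fun τ => ω τ x) (ω t x * hilbertTransform (ω t) x + ν * ωxx t x) t) ∧
      (∀ M : ℝ, ∀ᶠ t in 𝓝[<] T, ∃ x : ℝ, M ≤ |ω t x|) ∧
      ∃ M : ℝ, 0 < M ∧ M ≤ ε ∧ (∀ x, |ω 0 x| ≤ M) ∧ (∃ x₀, M / 3 ≤ |ω 0 x₀|) ∧ 4 ≤ T * M ∧ T * M ≤ 5 := by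
  obtain ⟨hk, hk0, hk6⟩ := root_k
  set k : ℝ := 3 + Real.sqrt 6 with hkdef
  have hk5 : 5 ≤ k := by
    have h2 : (2:ℝ) ≤ Real.sqrt 6 := by
      rw [show (2:ℝ) = Real.sqrt 4 by rw [show (4:ℝ) = 2 ^ 2 by norm_num, Real.sqrt_sq (by norm_num)]]
      exact Real.sqrt_le_sqrt (by norm_num)
    rw [hkdef]; linarith
  set L : ℝ := Real.sqrt (123 * ν / ε) + 672 * ν / ε + 1 with hLdef
  have hL : 0 < L := by positivity
  set s : ℝ → ℝ := fun t => Real.sqrt (L ^ 2 + 40 * k * ν * t) with hsdef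
  set y : ℝ → ℝ := fun t => (3 * L - s t) / 2 with hydef
  set ω : ℝ → ℝ → ℝ := fun t x => (-24 * k * ν / s t) * (x / (x ^ 2 + y t ^ 2) - x / (x ^ 2 + (y t + s t) ^ 2))
      + (-12 * ν) * (2 * y t * x / (x ^ 2 + y t ^ 2) ^ 2 + 2 * (y t + s t) * x / (x ^ 2 + (y t + s t) ^ 2) ^ 2)
    with hωdef
  set ωx : ℝ → ℝ → ℝ := fun t x => (-24 * k * ν / s t) * ((y t ^ 2 - x ^ 2) / (x ^ 2 + y t ^ 2) ^ 2
        - ((y t + s t) ^ 2 - x ^ 2) / (x ^ 2 + (y t + s t) ^ 2) ^ 2)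
      + (-12 * ν) * (2 * y t * (y t ^ 2 - 3 * x ^ 2) / (x ^ 2 + y t ^ 2) ^ 3
        + 2 * (y t + s t) * ((y t + s t) ^ 2 - 3 * x ^ 2) / (x ^ 2 + (y t + s t) ^ 2) ^ 3) with hωxdef
  set ωxx : ℝ → ℝ → ℝ := fun t x => (-24 * k * ν / s t) * (2 * x * (x ^ 2 - 3 * y t ^ 2) / (x ^ 2 + y t ^ 2) ^ 3
        - 2 * x * (x ^ 2 - 3 * (y t + s t) ^ 2) / (x ^ 2 + (y t + s t) ^ 2) ^ 3)
      + (-12 * ν) * (24 * y t * x * (x ^ 2 - y t ^ 2) / (x ^ 2 + y t ^ 2) ^ 4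
        + 24 * (y t + s t) * x * (x ^ 2 - (y t + s t) ^ 2) / (x ^ 2 + (y t + s t) ^ 2) ^ 4) with hωxxdef
  have hs : ∀ t, s t = Real.sqrt (L ^ 2 + 40 * k * ν * t) := fun t => rfl
  have hy : ∀ t, y t = (3 * L - s t) / 2 := fun t => rfl
  have hω : ∀ t x, ω t x = (-24 * k * ν / s t) * (x / (x ^ 2 + y t ^ 2) - x / (x ^ 2 + (y t + s t) ^ 2))
      + (-12 * ν) * (2 * y t * x / (x ^ 2 + y t ^ 2) ^ 2 + 2 * (y t + s t) * x / (x ^ 2 + (y t + s t) ^ 2) ^ 2) :=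
    fun t x => rfl
  have hωx : ∀ t x, ωx t x = (-24 * k * ν / s t) * ((y t ^ 2 - x ^ 2) / (x ^ 2 + y t ^ 2) ^ 2
        - ((y t + s t) ^ 2 - x ^ 2) / (x ^ 2 + (y t + s t) ^ 2) ^ 2)
      + (-12 * ν) * (2 * y t * (y t ^ 2 - 3 * x ^ 2) / (x ^ 2 + y t ^ 2) ^ 3
        + 2 * (y t + s t) * ((y t + s t) ^ 2 - 3 * x ^ 2) / (x ^ 2 + (y t + s t) ^ 2) ^ 3) := fun t x => rfl
  have hωxx : ∀ t x, ωxx t x = (-24 * k * ν / s t) * (2 * x * (x ^ 2 - 3 * y t ^ 2) / (x ^ 2 + y t ^ 2) ^ 3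
        - 2 * x * (x ^ 2 - 3 * (y t + s t) ^ 2) / (x ^ 2 + (y t + s t) ^ 2) ^ 3)
      + (-12 * ν) * (24 * y t * x * (x ^ 2 - y t ^ 2) / (x ^ 2 + y t ^ 2) ^ 4
        + 24 * (y t + s t) * x * (x ^ 2 - (y t + s t) ^ 2) / (x ^ 2 + (y t + s t) ^ 2) ^ 4) := fun t x => rfl
  have hσ : (0:ℝ) < 3 * L := by positivity
  have h3L : L < 3 * L := by linarith
  have hT : 0 < ((3 * L) ^ 2 - L ^ 2) / (40 * k * ν) := blowupTime_pos hν hk0 hL h3L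
  have hrad : ∀ t, 0 ≤ t → 0 < L ^ 2 + 40 * k * ν * t := fun t ht => radicand_pos hν hk0 hL ht
  have hst : ∀ t, 0 ≤ t → 0 < s t := fun t ht => sep_pos hs (hrad t ht)
  have hyt : ∀ t, t < ((3 * L) ^ 2 - L ^ 2) / (40 * k * ν) → 0 < y t :=
    fun t ht => depth_pos hν hk0 hσ hs hy ht
  refine ⟨((3 * L) ^ 2 - L ^ 2) / (40 * k * ν), hT, ω, ωx, ωxx, ?_, ?_, ?_, ?_, 123 * ν / L ^ 2, by positivity,
    ?_, ?_, ?_, ?_, ?_⟩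
  · intro t x ht0 htT
    exact hasDerivAt_solution_x hω hωx (hyt t htT) (hst t ht0) x
  · intro t x ht0 htT
    exact hasDerivAt_solution_xx hωx hωxx (hyt t htT) (hst t ht0) x
  · intro t x ht0 htT
    exact hasDerivAt_solution_t hk hs hy hω hωxx (hrad t ht0) (hyt t htT) x
  · intro M
    have hup := tendsto_inv_depth_pow hν hk0 hσ hs hy (n := 2) (by norm_num) (by positivity : (0:ℝ) < 6 * ν)
    have hpos : ∀ᶠ t in 𝓝[<] (((3 * L) ^ 2 - L ^ 2) / (40 * k * ν)), 0 < t :=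
      (lt_mem_nhds hT).filter_mono nhdsWithin_le_nhds
    filter_upwards [hpos, self_mem_nhdsWithin, hup.eventually_ge_atTop M] with t ht0 htT hM
    refine ⟨y t, hM.trans ?_⟩
    have h := solution_at_depth_le hν hk0 hω (hyt t htT) (hst t ht0.le)
    have hnn : 0 ≤ 6 * ν / y t ^ 2 := by
      have := hyt t htT
      positivity
    rw [abs_of_nonpos (h.trans (neg_nonpos.2 hnn))]
    linarith
  · -- `M = 123ν/L² ≤ ε`
    have hL2 : 123 * ν / ε ≤ L ^ 2 := by
      have h1 : Real.sqrt (123 * ν / ε) ≤ L := by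
        rw [hLdef]
        have : 0 ≤ 672 * ν / ε := by positivity
        linarith
      calc 123 * ν / ε = Real.sqrt (123 * ν / ε) ^ 2 := (Real.sq_sqrt (by positivity)).symm
        _ ≤ L ^ 2 := by gcongr
    rw [div_le_iff₀ (by positivity)]
    have := (div_le_iff₀ hε).1 hL2
    linarith
  · intro x
    exact solution_initial_abs_le hν hk0 hk6 hL hs hy hω x
  · -- the witness `x₀ = L`: `ω₀(L) = −(7.2k + 7.92)ν/L²`
    refine ⟨L, ?_⟩
    have hs0 : s 0 = L := by rw [hs]; simp [Real.sqrt_sq hL.le]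
    have hy0 : y 0 = L := by rw [hy, hs0]; ring
    have e : ω 0 L = -((36 * k + 198 / 5) / 5) * ν / L ^ 2 := by
      rw [hω, hy0, hs0]
      field_simp
      ring
    rw [e, abs_of_neg (by
      apply div_neg_of_neg_of_pos _ (by positivity)
      have : 0 < (36 * k + 198 / 5) / 5 * ν := by positivity
      linarith)]
    rw [show -(-((36 * k + 198 / 5) / 5) * ν / L ^ 2) = (36 * k + 198 / 5) / 5 * ν / L ^ 2 by ring,
      show 123 * ν / L ^ 2 / 3 = 41 * ν / L ^ 2 by ring]
    exact div_le_div_of_nonneg_right (by nlinarith) (by positivity)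
  · -- `4 ≤ T·M`: `T·M = 24.6/k`, `k ≤ 6`
    have e : ((3 * L) ^ 2 - L ^ 2) / (40 * k * ν) * (123 * ν / L ^ 2) = 123 / (5 * k) := by
      field_simp
      ring
    rw [e, le_div_iff₀ (by positivity)]
    nlinarith
  · -- `T·M ≤ 5`: `k ≥ 5`
    have e : ((3 * L) ^ 2 - L ^ 2) / (40 * k * ν) * (123 * ν / L ^ 2) = 123 / (5 * k) := by
      field_simp
      ring
    rw [e, div_le_iff₀ (by positivity)]
    nlinarith

end SheetNSLineSchochetTwoPole
end Summit.NavierStokesRegularity.OSWSelfSimilar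

end
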